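import Summits.HubbardSuperconductivity.HubbardSuperconductivity.Theorems.BalabanIRBirComplexStableXYRCubicNormalFormKernel
import HarnessLib

/-!
# Crux `BirComplexStableXYR`, line `fat-gaussian-defect-calculus`: stub S1 `stub_cubicNormalForm`

Registered stub (lead a4/c4, skeleton `Cruxes/BirComplexStableXYR/Lines/fat_gaussian_defect_calculus.lean`):
**in-class re-tabling with vanishing window Im-Hessian.**  For every `r` there is `C_r ≥ 1` (in fact
`C = 1 + e²` works for all `r`) such that every zero-sum, (R)- and (P)-symmetric table `c` can be
replaced by a table `c'` with the same symmetries, the same total coefficient, `normA c' ≤ C·normA c`,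
the SAME real part `Re F` pointwise, the SAME action on every torus, and `Σ_n Im(c'_n)(n·v)² = 0`
for all `v` (the imaginary part of the window Hessian at zero field vanishes).

## Construction (explicit; escalated route prover, seat 0; part 2 of 2, kernel lemmas in
## `BalabanIRBirComplexStableXYRCubicNormalFormKernel.lean`)

Let `A_{ww'} := Σ_n Im(c_n) n_w n_{w'}` and `c' := c + d`, `d := Σ_{(w,w')} (A_{ww'}/2)·i·δ_{e_w − e_{w'}}`.

* zero-sum support gives zero row sums of `A`; (R),(P) give `A_{ιw,ιw'} = −A_{ww'}` for the point
  reflection `ι` of the window, and the pairing lemma kills `Σ A_{ww'} G(w,w')` for every `G` with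
  `G(ιw,ιw') = G(w',w)`;
* here: `sh s (ιw) = sh (s + t) w'` (`cnf_sh_iota`) makes the torus pair sum
  `G_θ(w,w') = Σ_s e^{i(θ(sh s w) − θ(sh s w'))}` such a `G`, so the action of `d` vanishes on EVERY
  torus (`cnf_sum_genF_d`); `Re F_d ≡ 0`; `Σ_n Im(c'_n)(n·v)² = Σ_w v_w²·(row sum) = 0`;
  `normA d ≤ e²·normA c` (`cnf_normA_d_le`, `cnf_sum_abs_A_le`).
No definitions; sorry-free.
-/

noncomputable section

set_option linter.dupNamespace false -- summit = problem name (single-conjunct summit), D-0017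

namespace Summit.HubbardSuperconductivity.HubbardSuperconductivity.Theorems.FatGaussian

open scoped BigOperators ComplexConjugate
open Finset Summit.HubbardSuperconductivity.BirComplexStableXYNegative

variable {r : ℕ}

/-! ### Functionals of `d` -/

/-- `tsum d = (i/2) Σ_p A_p`. [folklore] -/
theorem cnf_tsum_d (A : W r → W r → ℝ) :
    Summit.HubbardSuperconductivity.BirComplexStableXYNegative.tsum (∑ p : W r × W r, Finsupp.single (Pi.single p.1 (1:ℤ) - Pi.single p.2 (1:ℤ) : Freq r)
        (((A p.1 p.2 / 2 : ℝ) : ℂ) * Complex.I)) =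
      ∑ p : W r × W r, ((A p.1 p.2 / 2 : ℝ) : ℂ) * Complex.I := by
  rw [cnf_tsum_sum]
  simp only [Summit.HubbardSuperconductivity.BirComplexStableXYNegative.tsum_single]

/-- `F_d(φ) = Σ_p (i/2) A_p e^{i(φ_{p.1} − φ_{p.2})}`. [folklore] -/
theorem cnf_genF_d (A : W r → W r → ℝ) (φ : W r → ℝ) :
    genF (∑ p : W r × W r, Finsupp.single (Pi.single p.1 (1:ℤ) - Pi.single p.2 (1:ℤ) : Freq r)
        (((A p.1 p.2 / 2 : ℝ) : ℂ) * Complex.I)) φ =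
      ∑ p : W r × W r, ((A p.1 p.2 / 2 : ℝ) : ℂ) * Complex.I *
        Complex.exp (Complex.I * ((φ p.1 - φ p.2 : ℝ) : ℂ)) := by
  rw [cnf_genF_sum]
  refine Finset.sum_congr rfl fun p _ => ?_
  rw [genF_single, ch, cnf_sum_delta_mul]

/-- `Re F_d ≡ 0` for symmetric `A` (sine antisymmetry). [folklore] -/
theorem cnf_re_genF_d (A : W r → W r → ℝ) (hsymm : ∀ w w', A w w' = A w' w) (φ : W r → ℝ) :
    (genF (∑ p : W r × W r, Finsupp.single (Pi.single p.1 (1:ℤ) - Pi.single p.2 (1:ℤ) : Freq r)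
        (((A p.1 p.2 / 2 : ℝ) : ℂ) * Complex.I)) φ).re = 0 := by
  rw [cnf_genF_d, Complex.re_sum]
  have hterm : ∀ p : W r × W r, (((A p.1 p.2 / 2 : ℝ) : ℂ) * Complex.I *
      Complex.exp (Complex.I * ((φ p.1 - φ p.2 : ℝ) : ℂ))).re = -(A p.1 p.2 / 2 * Real.sin (φ p.1 - φ p.2)) := by
    intro p
    have hexp : Complex.exp (Complex.I * ((φ p.1 - φ p.2 : ℝ) : ℂ)) =
        ((Real.cos (φ p.1 - φ p.2) : ℝ) : ℂ) + ((Real.sin (φ p.1 - φ p.2) : ℝ) : ℂ) * Complex.I := by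
      rw [mul_comm, Complex.exp_mul_I, ← Complex.ofReal_cos, ← Complex.ofReal_sin]
    rw [hexp]
    simp only [Complex.mul_re, Complex.mul_im, Complex.add_re, Complex.add_im, Complex.I_re,
      Complex.I_im, Complex.ofReal_re, Complex.ofReal_im, mul_zero, mul_one, zero_mul, sub_zero,
      zero_add, add_zero, zero_sub]
  simp only [hterm, Finset.sum_neg_distrib, neg_eq_zero]
  -- `Σ_p A_p sin(φ_{p.1} − φ_{p.2}) = 0` by the swap antisymmetry
  have hanti : ∑ p : W r × W r, A p.1 p.2 / 2 * Real.sin (φ p.1 - φ p.2) =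
      -∑ p : W r × W r, A p.1 p.2 / 2 * Real.sin (φ p.1 - φ p.2) := by
    rw [← Finset.sum_neg_distrib]
    refine Fintype.sum_equiv (Equiv.prodComm (W r) (W r)) _ _ fun p => ?_
    simp only [Equiv.prodComm_apply, Prod.fst_swap, Prod.snd_swap]
    rw [hsymm p.2 p.1, ← neg_sub (φ p.1) (φ p.2), Real.sin_neg]
    ring
  linarith


/-! ### The torus: point reflection of the window is a re-shift -/

/-- **Point reflection of the window is a torus translation followed by the swap**: with
`t = ((r−1)·𝟙 − ŵ − ŵ')`, `sh s (ιw) = sh (s + t) w'` (and symmetrically in `w, w'`). [folklore] -/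
theorem cnf_sh_iota {L M : ℕ} (s : Λ L M) (w w' : W r) :
    sh L M s (Fin.rev w.1, Fin.rev w.2.1, Fin.rev w.2.2) =
      sh L M (s + ((![((r : ℕ) : ZMod L) - 1, ((r : ℕ) : ZMod L) - 1]
          - ![((w.1 : ℕ) : ZMod L), ((w.2.1 : ℕ) : ZMod L)] - ![((w'.1 : ℕ) : ZMod L), ((w'.2.1 : ℕ) : ZMod L)],
        ((r : ℕ) : ZMod M) - 1 - ((w.2.2 : ℕ) : ZMod M) - ((w'.2.2 : ℕ) : ZMod M)) : Λ L M)) w' := by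
  have h1 : (((Fin.rev w.1 : Fin r) : ℕ) : ZMod L) = ((r : ℕ) : ZMod L) - 1 - ((w.1 : ℕ) : ZMod L) := by
    rw [Fin.val_rev, Nat.cast_sub (by omega)]; push_cast; ring
  have h2 : (((Fin.rev w.2.1 : Fin r) : ℕ) : ZMod L) = ((r : ℕ) : ZMod L) - 1 - ((w.2.1 : ℕ) : ZMod L) := by
    rw [Fin.val_rev, Nat.cast_sub (by omega)]; push_cast; ring
  have h3 : (((Fin.rev w.2.2 : Fin r) : ℕ) : ZMod M) = ((r : ℕ) : ZMod M) - 1 - ((w.2.2 : ℕ) : ZMod M) := by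
    rw [Fin.val_rev, Nat.cast_sub (by omega)]; push_cast; ring
  unfold sh
  simp only [Prod.fst_add, Prod.snd_add, Prod.mk.injEq]
  refine ⟨?_, ?_⟩
  · rw [h1, h2]
    funext i
    fin_cases i <;> simp [Matrix.vecHead, Matrix.vecTail] <;> ring
  · rw [h3]; ring

/-- The window-pair sum `G_θ(w,w') = Σ_s g(θ(sh s w), θ(sh s w'))` satisfies the covariance
`G(ιw, ιw') = G(w', w)` of the pairing lemma. [folklore] -/
theorem cnf_G_iota {V : Type*} [AddCommMonoid V] {L M : ℕ} [NeZero L] [NeZero M]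
    (g : Λ L M → Λ L M → V) (w w' : W r) :
    ∑ s : Λ L M, g (sh L M s (Fin.rev w.1, Fin.rev w.2.1, Fin.rev w.2.2))
        (sh L M s (Fin.rev w'.1, Fin.rev w'.2.1, Fin.rev w'.2.2)) =
      ∑ s : Λ L M, g (sh L M s w') (sh L M s w) := by
  set t : Λ L M := ((![((r : ℕ) : ZMod L) - 1, ((r : ℕ) : ZMod L) - 1]
          - ![((w.1 : ℕ) : ZMod L), ((w.2.1 : ℕ) : ZMod L)] - ![((w'.1 : ℕ) : ZMod L), ((w'.2.1 : ℕ) : ZMod L)],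
        ((r : ℕ) : ZMod M) - 1 - ((w.2.2 : ℕ) : ZMod M) - ((w'.2.2 : ℕ) : ZMod M)) : Λ L M) with ht
  have hw : ∀ s : Λ L M, sh L M s (Fin.rev w.1, Fin.rev w.2.1, Fin.rev w.2.2) = sh L M (s + t) w' :=
    fun s => cnf_sh_iota s w w'
  have hw' : ∀ s : Λ L M, sh L M s (Fin.rev w'.1, Fin.rev w'.2.1, Fin.rev w'.2.2) = sh L M (s + t) w := by
    intro s
    rw [cnf_sh_iota s w' w]
    congr 1
    rw [ht]
    ext i
    · simp only [Prod.fst_add]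
      ring
    · simp only [Prod.snd_add]
      ring
  simp only [hw, hw']
  exact Fintype.sum_equiv (Equiv.addRight t) _ _ fun s => rfl

/-- **The action of `d` vanishes on every torus.** [folklore] -/
theorem cnf_sum_genF_d {L M : ℕ} [NeZero L] [NeZero M] (A : W r → W r → ℝ)
    (hsymm : ∀ w w', A w w' = A w' w)
    (hodd : ∀ w w', A (Fin.rev w.1, Fin.rev w.2.1, Fin.rev w.2.2) (Fin.rev w'.1, Fin.rev w'.2.1, Fin.rev w'.2.2) = -A w w')
    (θ : Λ L M → ℝ) :
    ∑ s : Λ L M, genF (∑ p : W r × W r, Finsupp.single (Pi.single p.1 (1:ℤ) - Pi.single p.2 (1:ℤ) : Freq r)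
        (((A p.1 p.2 / 2 : ℝ) : ℂ) * Complex.I)) (fun w => θ (sh L M s w)) = 0 := by
  simp only [cnf_genF_d]
  rw [Finset.sum_comm]
  -- `Σ_p (A_p/2) • (i Σ_s e^{i(θ(sh s p₁) − θ(sh s p₂))}) = 0` by the pairing lemma
  have hpair := cnf_sum_pair_eq_zero (V := ℂ) (fun w w' => A w w' / 2)
    (fun w w' => by simp only [hsymm w w'])
    (fun w w' => by simp only [hodd w w']; ring)
    (fun w w' => Complex.I * ∑ s : Λ L M, Complex.exp (Complex.I * ((θ (sh L M s w) - θ (sh L M s w') : ℝ) : ℂ)))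
    (fun w w' => by
      exact congrArg (fun z => Complex.I * z)
        (cnf_G_iota (fun x y => Complex.exp (Complex.I * ((θ x - θ y : ℝ) : ℂ))) w w'))
  rw [Fintype.sum_prod_type]
  simp only [Complex.real_smul, Finset.mul_sum] at hpair
  convert hpair using 2 with w _
  refine Finset.sum_congr rfl fun w' _ => ?_
  refine Finset.sum_congr rfl fun s _ => ?_
  push_cast
  ring

/-- The Im-Hessian functional of `d`: `Σ_p (A_p/2)(v_{p.1} − v_{p.2})²`. [folklore] -/
theorem cnf_imH_d (A : W r → W r → ℝ) (v : W r → ℝ) :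
    (∑ p : W r × W r, Finsupp.single (Pi.single p.1 (1:ℤ) - Pi.single p.2 (1:ℤ) : Freq r)
        (((A p.1 p.2 / 2 : ℝ) : ℂ) * Complex.I)).sum (fun n a => a.im * (∑ w, (n w : ℝ) * v w) ^ 2) =
      ∑ p : W r × W r, A p.1 p.2 / 2 * (v p.1 - v p.2) ^ 2 := by
  rw [cnf_imH_sum]
  refine Finset.sum_congr rfl fun p _ => ?_
  rw [Finsupp.sum_single_index (by simp), cnf_sum_delta_mul]
  simp [Complex.mul_im]

/-- `normA d ≤ (e²/2) Σ_p |A_p|`. [folklore] -/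
theorem cnf_normA_d_le (A : W r → W r → ℝ) :
    normA (∑ p : W r × W r, Finsupp.single (Pi.single p.1 (1:ℤ) - Pi.single p.2 (1:ℤ) : Freq r)
        (((A p.1 p.2 / 2 : ℝ) : ℂ) * Complex.I)) ≤
      Real.exp 2 / 2 * ∑ p : W r × W r, |A p.1 p.2| := by
  refine (cnf_normA_sum_le _ _).trans ?_
  rw [Finset.mul_sum]
  refine Finset.sum_le_sum fun p _ => ?_
  rw [normA_single]
  have hn : ‖((A p.1 p.2 / 2 : ℝ) : ℂ) * Complex.I‖ = |A p.1 p.2| / 2 := by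
    rw [norm_mul, Complex.norm_I, mul_one, Complex.norm_real, Real.norm_eq_abs, abs_div, abs_two]
  rw [hn]
  have he : Real.exp (∑ w, |(((Pi.single p.1 (1:ℤ) - Pi.single p.2 (1:ℤ) : Freq r) w : ℤ) : ℝ)|) ≤ Real.exp 2 :=
    Real.exp_le_exp.mpr (cnf_sum_abs_delta_le p)
  calc |A p.1 p.2| / 2 * Real.exp (∑ w, |(((Pi.single p.1 (1:ℤ) - Pi.single p.2 (1:ℤ) : Freq r) w : ℤ) : ℝ)|)
      ≤ |A p.1 p.2| / 2 * Real.exp 2 := by gcongr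
    _ = Real.exp 2 / 2 * |A p.1 p.2| := by ring

/-! ### The table side: the Im-Hessian of `c` and the size of `A` -/

/-- `Σ_n Im(c_n)(n·v)² = Σ_{w,w'} A_{ww'} v_w v_{w'}`. [folklore] -/
theorem cnf_imH_c (c : Table r) (v : W r → ℝ) :
    c.sum (fun n a => a.im * (∑ w, (n w : ℝ) * v w) ^ 2) =
      ∑ w, ∑ w', c.sum (fun n a => a.im * ((n w : ℝ) * (n w' : ℝ))) * (v w * v w') := by
  simp only [Finsupp.sum, Finset.sum_mul]
  calc ∑ n ∈ c.support, (c n).im * (∑ w, (n w : ℝ) * v w) ^ 2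
      = ∑ n ∈ c.support, ∑ w, ∑ w', (c n).im * ((n w : ℝ) * (n w' : ℝ)) * (v w * v w') := by
        refine Finset.sum_congr rfl fun n _ => ?_
        rw [sq, Finset.sum_mul_sum, Finset.mul_sum]
        refine Finset.sum_congr rfl fun w _ => ?_
        rw [Finset.mul_sum]
        refine Finset.sum_congr rfl fun w' _ => ?_
        ring
    _ = ∑ w, ∑ n ∈ c.support, ∑ w', (c n).im * ((n w : ℝ) * (n w' : ℝ)) * (v w * v w') :=
        Finset.sum_comm
    _ = ∑ w, ∑ w', ∑ n ∈ c.support, (c n).im * ((n w : ℝ) * (n w' : ℝ)) * (v w * v w') := by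
        refine Finset.sum_congr rfl fun w _ => ?_
        exact Finset.sum_comm


/-- `Σ_{w,w'} |A_{ww'}| ≤ 2·normA c` (from `‖n‖₁² ≤ 2e^{‖n‖₁}`). [folklore] -/
theorem cnf_sum_abs_A_le (c : Table r) :
    ∑ p : W r × W r, |c.sum (fun n a => a.im * ((n p.1 : ℝ) * (n p.2 : ℝ)))| ≤ 2 * normA c := by
  simp only [Finsupp.sum, normA]
  calc ∑ p : W r × W r, |∑ n ∈ c.support, (c n).im * ((n p.1 : ℝ) * (n p.2 : ℝ))|
      ≤ ∑ p : W r × W r, ∑ n ∈ c.support, |(c n).im| * (|(n p.1 : ℝ)| * |(n p.2 : ℝ)|) := by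
        refine Finset.sum_le_sum fun p _ => (Finset.abs_sum_le_sum_abs _ _).trans_eq ?_
        refine Finset.sum_congr rfl fun n _ => ?_
        rw [abs_mul, abs_mul]
    _ = ∑ n ∈ c.support, |(c n).im| * (∑ w, |(n w : ℝ)|) ^ 2 := by
        rw [Finset.sum_comm]
        refine Finset.sum_congr rfl fun n _ => ?_
        rw [← Finset.mul_sum, Fintype.sum_prod_type, sq, Finset.sum_mul_sum]
    _ ≤ ∑ n ∈ c.support, ‖c n‖ * (2 * Real.exp (∑ w, |(n w : ℝ)|)) := by
        refine Finset.sum_le_sum fun n _ => ?_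
        have h1 : |(c n).im| ≤ ‖c n‖ := Complex.abs_im_le_norm _
        have h0 : 0 ≤ ∑ w, |(n w : ℝ)| := Finset.sum_nonneg fun w _ => abs_nonneg _
        have h2 : (∑ w, |(n w : ℝ)|) ^ 2 ≤ 2 * Real.exp (∑ w, |(n w : ℝ)|) := by
          have h := Real.quadratic_le_exp_of_nonneg h0
          nlinarith [Real.exp_pos (∑ w, |(n w : ℝ)|)]
        exact mul_le_mul h1 h2 (sq_nonneg _) (norm_nonneg _)
    _ = 2 * ∑ n ∈ c.support, ‖c n‖ * Real.exp (∑ w, |(n w : ℝ)|) := by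
        rw [Finset.mul_sum]
        refine Finset.sum_congr rfl fun n _ => ?_
        ring

/-! ### The stub -/

/-- **Stub S1 `stub_cubicNormalForm` (registered signature, verbatim): in-class re-tabling with
vanishing window Im-Hessian**, with the universal constant `C_r = 1 + e²`.  Construction
`c' = c + Σ_{(w,w')} (A_{ww'}/2)·i·δ_{e_w − e_{w'}}`, `A_{ww'} = Σ_n Im(c_n) n_w n_{w'}` (module
docstring). [folklore] -/
theorem stub_cubicNormalForm :
    ∀ r : ℕ, ∃ Cr : ℝ, 1 ≤ Cr ∧ ∀ c : Table r, (∀ n ∈ c.support, ∑ w, n w = 0) → (∀ n : Freq r, c (fun w => n (w.1, w.2.1, Fin.rev w.2.2)) = (starRingEnd ℂ) (c (-n))) → (∀ n : Freq r, c (fun w => n (Fin.rev w.1, Fin.rev w.2.1, w.2.2)) = c n) → ∃ c' : Table r, (∀ n ∈ c'.support, ∑ w, n w = 0) ∧ (∀ n : Freq r, c' (fun w => n (w.1, w.2.1, Fin.rev w.2.2)) = (starRingEnd ℂ) (c' (-n))) ∧ (∀ n : Freq r, c' (fun w => n (Fin.rev w.1, Fin.rev w.2.1, w.2.2)) = c'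 n) ∧ (c.sum (fun _ a => a) = 0 → c'.sum (fun _ a => a) = 0) ∧ (∀ B : ℝ, normA c ≤ B → normA c' ≤ Cr * B) ∧ (∀ φ : W r → ℝ, (genF c' φ).re = (genF c φ).re) ∧ (∀ (K : ℝ) (L M : ℕ) [NeZero L] [NeZero M] (θ : Λ L M → ℝ), action K c' L M θ = action K c L M θ) ∧ (∀ v : W r → ℝ, c'.sum (fun n a => a.im * (∑ w, (n w : ℝ) * v w) ^ 2) = 0) := by
  intro r
  refine ⟨1 + Real.exp 2, by linarith [Real.exp_pos 2], fun c hzs hR hP => ?_⟩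
  -- the coefficient matrix of the imaginary window Hessian and its symmetries
  set A : W r → W r → ℝ := fun w w' => c.sum (fun n a => a.im * ((n w : ℝ) * (n w' : ℝ))) with hA
  have hsymm : ∀ w w', A w w' = A w' w := fun w w' => cnf_A_symm c w w'
  have hAR : ∀ w w', A (w.1, w.2.1, Fin.rev w.2.2) (w'.1, w'.2.1, Fin.rev w'.2.2) = -A w w' :=
    fun w w' => cnf_A_R c hR w w'
  have hAP : ∀ w w', A (Fin.rev w.1, Fin.rev w.2.1, w.2.2) (Fin.rev w'.1, Fin.rev w'.2.1, w'.2.2) = A w w' :=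
    fun w w' => cnf_A_P c hP w w'
  have hAι : ∀ w w', A (Fin.rev w.1, Fin.rev w.2.1, Fin.rev w.2.2)
      (Fin.rev w'.1, Fin.rev w'.2.1, Fin.rev w'.2.2) = -A w w' := fun w w' => cnf_A_iota c hR hP w w'
  have hrow : ∀ w, ∑ w', A w w' = 0 := fun w => cnf_A_rowsum c hzs w
  have hcol : ∀ w', ∑ w, A w w' = 0 := fun w' => cnf_A_colsum c hzs w'
  have hAsum : ∑ p : W r × W r, A p.1 p.2 = 0 := by
    rw [Fintype.sum_prod_type]
    exact Finset.sum_eq_zero fun w _ => hrow w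
  -- the re-tabled `c' = c + d`
  refine ⟨c + ∑ p : W r × W r, Finsupp.single (Pi.single p.1 (1:ℤ) - Pi.single p.2 (1:ℤ) : Freq r)
      (((A p.1 p.2 / 2 : ℝ) : ℂ) * Complex.I), ?_, ?_, ?_, ?_, ?_, ?_, ?_, ?_⟩
  · -- zero-sum support
    exact condU1_add hzs (cnf_d_zeroSum A)
  · -- (R)
    intro n
    rw [Finsupp.add_apply, Finsupp.add_apply, map_add, hR n, cnf_d_R A hAR n, cnf_d_conj_neg A hsymm n]
  · -- (P)
    intro n
    rw [Finsupp.add_apply, Finsupp.add_apply, hP n, cnf_d_P A hAP n]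
  · -- total coefficient
    intro h0
    change Summit.HubbardSuperconductivity.BirComplexStableXYNegative.tsum _ = 0
    change Summit.HubbardSuperconductivity.BirComplexStableXYNegative.tsum c = 0 at h0
    rw [Summit.HubbardSuperconductivity.BirComplexStableXYNegative.tsum_add, h0, zero_add, cnf_tsum_d,
      ← Finset.sum_mul]
    have : ∑ p : W r × W r, ((A p.1 p.2 / 2 : ℝ) : ℂ) = 0 := by
      rw [← Complex.ofReal_sum, ← Finset.sum_div, hAsum, zero_div, Complex.ofReal_zero]
    rw [this, zero_mul]
  · -- norm
    intro B hB
    have hd : normA (∑ p : W r × W r, Finsupp.single (Pi.single p.1 (1:ℤ) - Pi.single p.2 (1:ℤ) : Freq r)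
        (((A p.1 p.2 / 2 : ℝ) : ℂ) * Complex.I)) ≤ Real.exp 2 * normA c := by
      refine (cnf_normA_d_le A).trans ?_
      have := cnf_sum_abs_A_le c
      have he : 0 ≤ Real.exp 2 / 2 := by positivity
      calc Real.exp 2 / 2 * ∑ p : W r × W r, |A p.1 p.2| ≤ Real.exp 2 / 2 * (2 * normA c) :=
            mul_le_mul_of_nonneg_left this he
        _ = Real.exp 2 * normA c := by ring
    have hc0 : 0 ≤ normA c := normA_nonneg c
    calc normA (c + _) ≤ normA c + normA _ := normA_add_le _ _
      _ ≤ normA c + Real.exp 2 * normA c := by linarith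
      _ = (1 + Real.exp 2) * normA c := by ring
      _ ≤ (1 + Real.exp 2) * B := by
          exact mul_le_mul_of_nonneg_left hB (by positivity)
  · -- real part of `F`
    intro φ
    rw [genF_add, Complex.add_re, cnf_re_genF_d A hsymm φ, add_zero]
  · -- the action on every torus
    intro K L M _ _ θ
    unfold action
    congr 1
    simp only [genF_add, Finset.sum_add_distrib, cnf_sum_genF_d A hsymm hAι θ, add_zero]
  · -- the imaginary window Hessian
    intro v
    rw [Finsupp.sum_add_index' (fun n => by simp) (fun n b₁ b₂ => by rw [Complex.add_im]; ring),
      cnf_imH_c, cnf_imH_d]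
    have hp := Fintype.sum_prod_type (fun p : W r × W r => A p.1 p.2 / 2 * (v p.1 - v p.2) ^ 2)
    dsimp only at hp
    rw [hp]
    change ∑ w, ∑ w', A w w' * (v w * v w') + ∑ w, ∑ w', A w w' / 2 * (v w - v w') ^ 2 = 0
    rw [← Finset.sum_add_distrib]
    have hterm : ∀ w, (∑ w', A w w' * (v w * v w')) + ∑ w', A w w' / 2 * (v w - v w') ^ 2 =
        (∑ w', v w ^ 2 / 2 * A w w') + ∑ w', v w' ^ 2 / 2 * A w w' := by
      intro w
      rw [← Finset.sum_add_distrib, ← Finset.sum_add_distrib]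
      refine Finset.sum_congr rfl fun w' _ => ?_
      ring
    simp only [hterm, Finset.sum_add_distrib]
    have h1 : ∑ w, ∑ w', v w ^ 2 / 2 * A w w' = 0 := by
      refine Finset.sum_eq_zero fun w _ => ?_
      rw [← Finset.mul_sum, hrow w, mul_zero]
    have h2 : ∑ w, ∑ w', v w' ^ 2 / 2 * A w w' = 0 := by
      rw [Finset.sum_comm]
      refine Finset.sum_eq_zero fun w' _ => ?_
      rw [← Finset.mul_sum, hcol w', mul_zero]
    rw [h1, h2, add_zero]

end Summit.HubbardSuperconductivity.HubbardSuperconductivity.Theorems.FatGaussian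

end
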